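import Literature.NumberTheory.Automorphic.UnitaryGroupBorelTruncation
import HarnessLib

/-!
# Cusp forms on the quasi-split unitary group `U(J_N)` ALONG THE BOREL SUBGROUP — the repaired
# space of cusp forms on `U(J₃)` (`F`-rank one)

Topic `NumberTheory/Automorphic`; namespace `Literature.NumberTheory.Automorphic.UnitaryGroup`.
DEFINITIONS with bodies + proved structure lemmas; no named fact, no `sorry`, no instance, no
notation. Setting: Mok's / Rogawski's quasi-split unitary group `U_{E/F}(N) = U(J_N)`
(`UnitaryGroup.quasiSplit F E c N`, automorphy datum `quasiSplitDatum F E c N hcpt`), the unipotent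
radical `N(𝔸_F) = adelicUnipotent F E c N` of its standard (upper triangular) Borel subgroup with
rational points `N(F) = rationalUnipotent F E c N` (`UnitaryGroupGenericity`), the Borel constant
term `borelConstantTerm ν 𝓕 φ g = ν(𝓕)⁻¹ ∫_𝓕 φ(u g) dν(u)` and the data-free predicate
`BorelCuspCondition F E c N φ` («`φ_B ≡ 0` for every Haar measure `ν` of `N(𝔸_F)` and every
fundamental domain `𝓕` of `N(F)`») of `UnitaryGroupBorelTruncation`.

## Why this file exists (referee record R1-46; erratum `UnitaryGroupUnipotentRadicalCentre`)

The accepted `UnitaryGroup.unipotentRadical F E c N k` (`UnitaryGroupAutomorphicRep`, l. 939) is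
`U(J_N)(𝔸_F) ∩ (1 + 𝔫_k(𝔸_E))` with `𝔫_k` the ABELIAN radical of the `(k, N-k)` parabolic of `GL_N`;
for `2k < N` this is only the CENTRE `Z_k` of the unipotent radical `N_{P_k}` of the maximal parabolic
`P_k` of `U(J_N)` (`apply_superdiag_eq_zero_of_mem_unipotentRadical`; for `N = 3`, `k = 1`:
`unipotentRadical F E c 3 1 = Z(N) = {u(0, z)}`, `apply_superdiag_eq_zero_of_mem_unipotentRadical_three`).
Consequently the accepted `CuspCondition φ k` (l. 952), `IsCuspForm` (l. 1003), `cuspForms` (l. 1008)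
and `CuspidalAutomorphicRepData` (l. 1020) for `U_{E/F}(N)`, `N ≥ 3`, demand
`∫_{Z_k(F)\Z_k(𝔸_F)} φ(z g) dz = 0`: for `U(3)` this annihilates every Whittaker coefficient, so the
accepted «cusp forms» are the NON-GENERIC cusp forms — a proper subclass of the cusp forms of
Rogawski (1990), §2.1 («`φ ∈ L(G)` is called a cusp form if for all `P`, `φ_P(g) = 0`»,
`φ_P(g) = ∫_{N_P\𝐍_P} φ(ng) dn`) and of Mœglin–Waldspurger (1995), I.2.18 («`φ` is cuspidal if for
all standard parabolic subgroups `P₀ ⊂ P' ⊊ G` we have `φ_{P'} = 0`», constant terms I.2.6).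

This file types the printed notion ALONG THE BOREL SUBGROUP `B = T N`, over the genuine radical
`N(𝔸_F) = adelicUnipotent`:

* §1 `IsBorelCuspidal ν 𝓕 φ := ∀ g, borelConstantTerm ν 𝓕 φ g = 0` — the cusp condition along `B`
  for FIXED data (a measure `ν` on `N(𝔸_F)`, a set `𝓕 ⊆ N(𝔸_F)`); it is insensitive to rescaling the
  measure (`IsBorelCuspidal.smul_measure`), independent of the fundamental domain for left
  `U(F)`-invariant `φ` (`isBorelCuspidal_iff_of_isFundamentalDomain`, Mathlib
  `IsFundamentalDomain.setIntegral_eq`), and implied — for EVERY Haar measure and EVERY fundamental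
  domain at once — by the accepted data-free `BorelCuspCondition` (`BorelCuspCondition.isBorelCuspidal`),
  so a consumer may fix any Haar measure and any fundamental set.
* §2 `IsBorelCuspForm hcpt φ := IsAutomorphicForm (quasiSplitDatum F E c N hcpt) φ ∧ BorelCuspCondition F E c N φ`
  — the accepted `IsCuspForm` (l. 1003) token for token with its cusp conjunct
  `∀ k, 0 < k → 2 * k ≤ N → CuspCondition F E c N φ k` REPLACED by the accepted `BorelCuspCondition`;
  `borelCuspForms hcpt := Submodule.span ℂ {φ | IsBorelCuspForm F E c N hcpt φ}` — the accepted
  `cuspForms` (l. 1008) shape; every element of the span is left `U(F)`-invariant and Borel-cuspidal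
  (`borelCuspCondition_of_mem_borelCuspForms`, the conditions being linear), and
  `borelCuspForms ≤ automorphicForms`.

SCOPE (recorded, not asserted). For `F`-rank one — `N = 2, 3`, where the Borel subgroup is the only
proper standard parabolic of `U(J_N)` — `IsBorelCuspForm` / `borelCuspForms` ARE the cusp forms of
Rogawski (1990), §2.1 and Mœglin–Waldspurger (1995), I.2.18 (smooth, `K`-finite, `𝔷`-finite version,
Borel–Jacquet 4.4); in particular for `U(J₃)`. For `N ≥ 4` Borel-cuspidality is implied by, and
weaker than, cuspidality (the maximal parabolics `P_k`, `1 ≤ k ≤ N/2`, impose further constant-term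
conditions); the genuine radical of `P_k` is `U(J_N) ∩ unipotentRadicalGL` with block labelling
`(k, N-2k, k)` (erratum file, CONSEQUENCES).

COMPARISON WITH THE ACCEPTED NOTION (recorded, not asserted; no declaration). `Z_k ⊴ N` and
`φ_B(g) = ∫_{N(F)Z_k(𝔸_F)\N(𝔸_F)} φ_{Z_k}(n g) dn` (integration in stages), so for a left
`U(F)`-invariant `φ` the accepted `CuspCondition φ k` (`φ_{Z_k} ≡ 0`) IMPLIES `BorelCuspCondition φ`
(`φ_B ≡ 0`): the accepted `cuspForms` is contained in `borelCuspForms` (for `N = 3`: the non-generic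
cusp forms inside all cusp forms). The converse FAILS: a generic cusp form `φ` on `U(3)` has
`φ_N = 0` but `φ_Z = φ_N + Σ_{ψ ≠ 1} W_ψ ≠ 0` (Fourier expansion along the compact abelian group
`N(F)Z(𝔸_F)\N(𝔸_F) ≅ E\𝔸_E`, `W_ψ` the Whittaker coefficients `whittakerCoeff` of
`UnitaryGroupGenericity`). The inclusion `cuspForms ≤ borelCuspForms` (`N = 3`) is a Fubini argument
over the Heisenberg chart `heisHomeomorph` / `heisHaar` of `UnitaryGroupHeisenberg`; it is NOT
declared here (no unproved named fact is introduced).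

EDITION 2 (digits only, lit2 D-CITE word 2026-08-31): the Rogawski locator `§2.1` carries the printed pages
11–12 (Chapter 2 opens on p. 11 of the printed Contents); declarations and proofs unchanged.

## References

* J. D. Rogawski, *Automorphic Representations of Unitary Groups in Three Variables*, Annals of
  Mathematics Studies 123 (1990), §2.1 (pp. 11–12: `φ_P`, cusp forms, `L_0(G)`), §1.10 (`B = T N`
  for `U(3)`) [Rogawski1990].
* C. Mœglin, J.-L. Waldspurger, *Spectral Decomposition and Eisenstein Series* (1995), I.2.6
  (constant terms, p. 27), I.2.18 (cuspidal forms, p. 39) [MoeglinWaldspurger1995].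
* A. Borel, H. Jacquet, *Automorphic forms and automorphic representations*, Corvallis (1979), 4.2,
  4.4 [BorelJacquet1979].
-/

noncomputable section

open MeasureTheory NumberField IsDedekindDomain
open scoped ENNReal Classical

namespace Literature.NumberTheory.Automorphic

namespace UnitaryGroup

variable {F E : Type} [Field F] [NumberField F] [Field E] [NumberField E] [Algebra F E]
  {c : E ≃ₐ[F] E} {N : ℕ}

/-! ## §1 The cusp condition along the Borel subgroup for fixed data `(ν, 𝓕)` -/

section FixedData

variable [MeasurableSpace (adelicUnipotent F E c N)]

/-- **`φ` is cuspidal along the Borel subgroup for the data `(ν, 𝓕)`**: all Borel constant terms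
`φ_B(g) = ν(𝓕)⁻¹ ∫_𝓕 φ(u g) dν(u)` (`borelConstantTerm`, the integral over a fundamental domain `𝓕`
of `N(F)` in the FULL unipotent radical `N(𝔸_F) = adelicUnipotent F E c N` for a measure `ν`) vanish:
`∀ g, φ_B(g) = 0`. For `F`-rank one (`N = 2, 3`: `B` is the only proper standard parabolic of `U(J_N)`)
this is the cusp condition of Rogawski (1990), §2.1 («for all `P`, `φ_P(g) = 0`») and of
Mœglin–Waldspurger (1995), I.2.18, realised with fixed data; the data-free form (every Haar `ν`,
every fundamental domain `𝓕`) is the accepted `BorelCuspCondition`, which implies this one for all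
data at once (`BorelCuspCondition.isBorelCuspidal`). [cite: Rogawski1990, §2.1 (pp. 11–12)] -/
def IsBorelCuspidal (ν : Measure (adelicUnipotent F E c N)) (𝓕 : Set (adelicUnipotent F E c N))
    (φ : (quasiSplit F E c N).Adelic → ℂ) : Prop :=
  ∀ g : (quasiSplit F E c N).Adelic, borelConstantTerm ν 𝓕 φ g = 0

/-- Unfolding `IsBorelCuspidal`. [cite: Rogawski1990, §2.1 (pp. 11–12)] -/
theorem isBorelCuspidal_iff (ν : Measure (adelicUnipotent F E c N)) (𝓕 : Set (adelicUnipotent F E c N))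
    (φ : (quasiSplit F E c N).Adelic → ℂ) :
    IsBorelCuspidal ν 𝓕 φ ↔ ∀ g : (quasiSplit F E c N).Adelic, borelConstantTerm ν 𝓕 φ g = 0 :=
  Iff.rfl

/-- A Borel-cuspidal `φ` has vanishing Borel constant terms. [cite: Rogawski1990, §2.1 (pp. 11–12)] -/
theorem IsBorelCuspidal.borelConstantTerm_eq_zero {ν : Measure (adelicUnipotent F E c N)}
    {𝓕 : Set (adelicUnipotent F E c N)} {φ : (quasiSplit F E c N).Adelic → ℂ}
    (hφ : IsBorelCuspidal ν 𝓕 φ) (g : (quasiSplit F E c N).Adelic) : borelConstantTerm ν 𝓕 φ g = 0 :=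
  hφ g

/-- The zero function is Borel-cuspidal for every data. [cite: Rogawski1990, §2.1 (pp. 11–12)] -/
theorem IsBorelCuspidal.zero (ν : Measure (adelicUnipotent F E c N)) (𝓕 : Set (adelicUnipotent F E c N)) :
    IsBorelCuspidal ν 𝓕 (0 : (quasiSplit F E c N).Adelic → ℂ) :=
  fun g => borelConstantTerm_zero ν 𝓕 g

/-- Borel-cuspidality (fixed data) is preserved under sums, on integrable data.
[cite: Rogawski1990, §2.1 (pp. 11–12)] -/
theorem IsBorelCuspidal.add {ν : Measure (adelicUnipotent F E c N)} {𝓕 : Set (adelicUnipotent F E c N)}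
    {φ ψ : (quasiSplit F E c N).Adelic → ℂ} (hφ : IsBorelCuspidal ν 𝓕 φ) (hψ : IsBorelCuspidal ν 𝓕 ψ)
    (hφi : ∀ g : (quasiSplit F E c N).Adelic,
      IntegrableOn (fun u : adelicUnipotent F E c N => φ ((u : (quasiSplit F E c N).Adelic) * g)) 𝓕 ν)
    (hψi : ∀ g : (quasiSplit F E c N).Adelic,
      IntegrableOn (fun u : adelicUnipotent F E c N => ψ ((u : (quasiSplit F E c N).Adelic) * g)) 𝓕 ν) :
    IsBorelCuspidal ν 𝓕 (φ + ψ) := fun g => by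
  rw [borelConstantTerm_add ν 𝓕 g (hφi g) (hψi g), hφ g, hψ g, add_zero]

/-- Borel-cuspidality (fixed data) is preserved under scalars. [cite: Rogawski1990, §2.1 (pp. 11–12)] -/
theorem IsBorelCuspidal.smul {ν : Measure (adelicUnipotent F E c N)} {𝓕 : Set (adelicUnipotent F E c N)}
    {φ : (quasiSplit F E c N).Adelic → ℂ} (a : ℂ) (hφ : IsBorelCuspidal ν 𝓕 φ) :
    IsBorelCuspidal ν 𝓕 (a • φ) := fun g => by
  rw [borelConstantTerm_smul, hφ g, mul_zero]

/-- Borel-cuspidality (fixed data) is invariant under right translation: `(r(h)φ)_B(g) = φ_B(g h)`.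
[cite: Rogawski1990, §2.1 (pp. 11–12)] -/
theorem IsBorelCuspidal.rightTranslation {ν : Measure (adelicUnipotent F E c N)}
    {𝓕 : Set (adelicUnipotent F E c N)} {φ : (quasiSplit F E c N).Adelic → ℂ}
    (hφ : IsBorelCuspidal ν 𝓕 φ) (h : (quasiSplit F E c N).Adelic) :
    IsBorelCuspidal ν 𝓕 (rightTranslation (quasiSplit F E c N) h φ) := fun g => by
  rw [borelConstantTerm_rightTranslation, hφ (g * h)]

/-- **Rescaling the measure.** `φ_B` computed with `a • ν` is `(a ν(𝓕))⁻¹ · a · ∫_𝓕 φ(u g) dν(u)`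
(Mathlib `integral_smul_measure`). [cite: Rogawski1990, §2.1 (pp. 11–12)] -/
theorem borelConstantTerm_smul_measure (ν : Measure (adelicUnipotent F E c N))
    (𝓕 : Set (adelicUnipotent F E c N)) (a : ℝ≥0∞) (φ : (quasiSplit F E c N).Adelic → ℂ)
    (g : (quasiSplit F E c N).Adelic) :
    borelConstantTerm (a • ν) 𝓕 φ g =
      ((a * ν 𝓕).toReal⁻¹ : ℝ) • (a.toReal •
        ∫ u in 𝓕, φ ((u : (quasiSplit F E c N).Adelic) * g) ∂ν) := by
  rw [borelConstantTerm_def, Measure.restrict_smul, integral_smul_measure, Measure.smul_apply,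
    smul_eq_mul]

/-- **Borel-cuspidality does not depend on the normalisation of the measure**: if `φ_B ≡ 0` for
`(ν, 𝓕)` then `φ_B ≡ 0` for `(a • ν, 𝓕)`, every `a : ℝ≥0∞` (Haar measures on `N(𝔸_F)` differ by such
a scalar; degenerate masses `a ν(𝓕) ∈ {0, ∞}` give the junk value `0` on both sides).
[cite: Rogawski1990, §2.1 (pp. 11–12)] -/
theorem IsBorelCuspidal.smul_measure {ν : Measure (adelicUnipotent F E c N)}
    {𝓕 : Set (adelicUnipotent F E c N)} {φ : (quasiSplit F E c N).Adelic → ℂ}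
    (hφ : IsBorelCuspidal ν 𝓕 φ) (a : ℝ≥0∞) : IsBorelCuspidal (a • ν) 𝓕 φ := by
  intro g
  have h := hφ g
  rw [borelConstantTerm_def] at h
  rw [borelConstantTerm_smul_measure]
  rcases smul_eq_zero.1 h with h0 | hI
  · have ha : (a * ν 𝓕).toReal = 0 := by
      rw [ENNReal.toReal_mul, inv_eq_zero.1 h0, mul_zero]
    rw [ha, inv_zero, zero_smul]
  · rw [hI, smul_zero, smul_zero]

omit [MeasurableSpace (adelicUnipotent F E c N)] in
/-- **`N(F)`-invariance of the constant-term integrand.** If `φ` is left `U(F)`-invariant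
(`IsLeftInvariant`, e.g. an automorphic form on `U_{E/F}(N)`), then for `γ ∈ N(F)`:
`φ((γ u) g) = φ(u g)`, so `u ↦ φ(u g)` is a function on `N(F)\N(𝔸_F)` (Mœglin–Waldspurger (1995),
I.2.6: `φ_P` is defined for `φ` on `U(k)\G`). [cite: MoeglinWaldspurger1995, I.2.6 (p. 27)] -/
theorem borelIntegrand_smul {φ : (quasiSplit F E c N).Adelic → ℂ}
    (hφ : IsLeftInvariant (quasiSplit F E c N) φ) (g : (quasiSplit F E c N).Adelic)
    (γ : rationalUnipotent F E c N) (u : adelicUnipotent F E c N) :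
    φ (((γ • u : adelicUnipotent F E c N) : (quasiSplit F E c N).Adelic) * g) =
      φ ((u : (quasiSplit F E c N).Adelic) * g) := by
  have hγu : (γ • u : adelicUnipotent F E c N) = (γ : adelicUnipotent F E c N) * u := rfl
  rw [hγu, Subgroup.coe_mul, mul_assoc]
  exact hφ _ γ.2 _

/-- **The Borel constant term of a left `U(F)`-invariant `φ` does not depend on the fundamental
domain**: two fundamental domains of `N(F)` in `N(𝔸_F)` for an `N(F)`-invariant measure give the
same integral (Mathlib `IsFundamentalDomain.setIntegral_eq`) and the same mass
(`IsFundamentalDomain.measure_eq`) — the constant term is an integral over `N(F)\N(𝔸_F)`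
(Mœglin–Waldspurger (1995), I.2.6). [cite: MoeglinWaldspurger1995, I.2.6 (p. 27)] -/
theorem borelConstantTerm_eq_of_isFundamentalDomain [Countable (rationalUnipotent F E c N)]
    {ν : Measure (adelicUnipotent F E c N)}
    [MeasurableConstSMul (rationalUnipotent F E c N) (adelicUnipotent F E c N)]
    [SMulInvariantMeasure (rationalUnipotent F E c N) (adelicUnipotent F E c N) ν]
    {𝓕 𝓕' : Set (adelicUnipotent F E c N)} (h𝓕 : IsFundamentalDomain (rationalUnipotent F E c N) 𝓕 ν)
    (h𝓕' : IsFundamentalDomain (rationalUnipotent F E c N) 𝓕' ν)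
    {φ : (quasiSplit F E c N).Adelic → ℂ} (hφ : IsLeftInvariant (quasiSplit F E c N) φ)
    (g : (quasiSplit F E c N).Adelic) :
    borelConstantTerm ν 𝓕 φ g = borelConstantTerm ν 𝓕' φ g := by
  rw [borelConstantTerm_def, borelConstantTerm_def, h𝓕.measure_eq h𝓕',
    h𝓕.setIntegral_eq h𝓕' (f := fun u : adelicUnipotent F E c N =>
      φ ((u : (quasiSplit F E c N).Adelic) * g)) (fun γ u => borelIntegrand_smul hφ g γ u)]

/-- Hence **Borel-cuspidality of a left `U(F)`-invariant `φ` does not depend on the fundamental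
domain**. [cite: MoeglinWaldspurger1995, I.2.6 (p. 27)] -/
theorem isBorelCuspidal_iff_of_isFundamentalDomain [Countable (rationalUnipotent F E c N)]
    {ν : Measure (adelicUnipotent F E c N)}
    [MeasurableConstSMul (rationalUnipotent F E c N) (adelicUnipotent F E c N)]
    [SMulInvariantMeasure (rationalUnipotent F E c N) (adelicUnipotent F E c N) ν]
    {𝓕 𝓕' : Set (adelicUnipotent F E c N)} (h𝓕 : IsFundamentalDomain (rationalUnipotent F E c N) 𝓕 ν)
    (h𝓕' : IsFundamentalDomain (rationalUnipotent F E c N) 𝓕' ν)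
    {φ : (quasiSplit F E c N).Adelic → ℂ} (hφ : IsLeftInvariant (quasiSplit F E c N) φ) :
    IsBorelCuspidal ν 𝓕 φ ↔ IsBorelCuspidal ν 𝓕' φ := by
  simp only [IsBorelCuspidal, borelConstantTerm_eq_of_isFundamentalDomain h𝓕 h𝓕' hφ]

/-- **The data-free Borel cusp condition implies the fixed-data one for every Haar measure and
every fundamental domain at once** — so consumers of `BorelCuspCondition` may fix any Haar measure
of `N(𝔸_F)` and any fundamental set of `N(F)`. [cite: Rogawski1990, §2.1 (pp. 11–12)] -/
theorem BorelCuspCondition.isBorelCuspidal [BorelSpace (adelicUnipotent F E c N)]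
    {φ : (quasiSplit F E c N).Adelic → ℂ} (hφ : BorelCuspCondition F E c N φ)
    (ν : Measure (adelicUnipotent F E c N)) [ν.IsHaarMeasure]
    {𝓕 : Set (adelicUnipotent F E c N)} (h𝓕 : IsFundamentalDomain (rationalUnipotent F E c N) 𝓕 ν) :
    IsBorelCuspidal ν 𝓕 φ :=
  fun g => hφ.borelConstantTerm_eq_zero ν h𝓕 g

end FixedData

/-! ## §2 Borel cusp forms and their span -/

variable (F E c N)
variable (hcpt : isCompact_glFiniteIntegralLevel N E)

/-- **`φ : U_{E/F}(N)(𝔸_F) → ℂ` is a cusp form along the Borel subgroup**: an automorphic form for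
`quasiSplitDatum` (Borel–Jacquet 4.2: left `U(F)`-invariant, right invariant under a level, smooth and
`K_∞`-finite, `𝔷`-finite, of moderate growth) all of whose constant terms along the Borel subgroup
vanish — the accepted `BorelCuspCondition` («`φ_B ≡ 0` for every Haar measure of `N(𝔸_F)` and every
fundamental domain of `N(F)`»). This is the accepted `IsCuspForm` with its cusp conjunct (taken over
the centres `Z_k`, see the module docstring) replaced by the Borel one over the genuine radical
`N(𝔸_F)`. For `F`-rank one (`N = 2, 3`) these are exactly the cusp forms of Rogawski (1990), §2.1 /
Mœglin–Waldspurger (1995), I.2.18; for `N ≥ 4` the condition is weaker than cuspidality (recorded, not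
asserted). [cite: Rogawski1990, §2.1 (pp. 11–12)] -/
def IsBorelCuspForm (φ : (quasiSplit F E c N).Adelic → ℂ) : Prop :=
  IsAutomorphicForm (quasiSplitDatum F E c N hcpt) φ ∧ BorelCuspCondition F E c N φ

/-- **The space of Borel cusp forms on `U_{E/F}(N)`**: the complex span of the Borel cusp forms
(shape of the accepted `cuspForms`; Rogawski (1990), §2.1: «the subspace `L_0(G)` of cusp forms»;
Borel–Jacquet 4.4–4.6). [cite: Rogawski1990, §2.1 (pp. 11–12)] -/
def borelCuspForms : Submodule ℂ ((quasiSplit F E c N).Adelic → ℂ) :=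
  Submodule.span ℂ {φ | IsBorelCuspForm F E c N hcpt φ}

variable {F E c N hcpt}

/-- Unfolding `IsBorelCuspForm`. [cite: Rogawski1990, §2.1 (pp. 11–12)] -/
theorem isBorelCuspForm_iff (φ : (quasiSplit F E c N).Adelic → ℂ) :
    IsBorelCuspForm F E c N hcpt φ ↔
      IsAutomorphicForm (quasiSplitDatum F E c N hcpt) φ ∧ BorelCuspCondition F E c N φ :=
  Iff.rfl

/-- A Borel cusp form is an automorphic form. [cite: Rogawski1990, §2.1 (pp. 11–12)] -/
theorem IsBorelCuspForm.isAutomorphicForm {φ : (quasiSplit F E c N).Adelic → ℂ}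
    (hφ : IsBorelCuspForm F E c N hcpt φ) : IsAutomorphicForm (quasiSplitDatum F E c N hcpt) φ :=
  hφ.1

/-- A Borel cusp form satisfies the (data-free) Borel cusp condition. [cite: Rogawski1990, §2.1 (pp. 11–12)] -/
theorem IsBorelCuspForm.borelCuspCondition {φ : (quasiSplit F E c N).Adelic → ℂ}
    (hφ : IsBorelCuspForm F E c N hcpt φ) : BorelCuspCondition F E c N φ :=
  hφ.2

/-- A Borel cusp form is left `U(F)`-invariant. [cite: Rogawski1990, §2.1 (pp. 11–12)] -/
theorem IsBorelCuspForm.isLeftInvariant {φ : (quasiSplit F E c N).Adelic → ℂ}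
    (hφ : IsBorelCuspForm F E c N hcpt φ) : IsLeftInvariant (quasiSplit F E c N) φ :=
  hφ.1.leftInvariant

/-- A Borel cusp form is Borel-cuspidal for every Haar measure of `N(𝔸_F)` and every fundamental
domain of `N(F)`. [cite: Rogawski1990, §2.1 (pp. 11–12)] -/
theorem IsBorelCuspForm.isBorelCuspidal [MeasurableSpace (adelicUnipotent F E c N)]
    [BorelSpace (adelicUnipotent F E c N)] {φ : (quasiSplit F E c N).Adelic → ℂ}
    (hφ : IsBorelCuspForm F E c N hcpt φ) (ν : Measure (adelicUnipotent F E c N)) [ν.IsHaarMeasure]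
    {𝓕 : Set (adelicUnipotent F E c N)} (h𝓕 : IsFundamentalDomain (rationalUnipotent F E c N) 𝓕 ν) :
    IsBorelCuspidal ν 𝓕 φ :=
  BorelCuspCondition.isBorelCuspidal hφ.2 ν h𝓕

/-- Borel cusp forms are stable under right translation by elements preserving automorphy: if
`r(h)φ` is again an automorphic form then it is a Borel cusp form (`BorelCuspCondition.rightTranslation`).
[cite: Rogawski1990, §2.1 (pp. 11–12)] -/
theorem IsBorelCuspForm.rightTranslation {φ : (quasiSplit F E c N).Adelic → ℂ}
    (hφ : IsBorelCuspForm F E c N hcpt φ) (h : (quasiSplit F E c N).Adelic)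
    (hauto : IsAutomorphicForm (quasiSplitDatum F E c N hcpt) (rightTranslation (quasiSplit F E c N) h φ)) :
    IsBorelCuspForm F E c N hcpt (rightTranslation (quasiSplit F E c N) h φ) :=
  ⟨hauto, BorelCuspCondition.rightTranslation hφ.2 h⟩

/-- A Borel cusp form lies in the space of Borel cusp forms. [cite: Rogawski1990, §2.1 (pp. 11–12)] -/
theorem IsBorelCuspForm.mem_borelCuspForms {φ : (quasiSplit F E c N).Adelic → ℂ}
    (hφ : IsBorelCuspForm F E c N hcpt φ) : φ ∈ borelCuspForms F E c N hcpt :=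
  Submodule.subset_span hφ

/-- **Borel cusp forms are automorphic forms**: `borelCuspForms ≤ automorphicForms` (both spans).
[cite: Rogawski1990, §2.1 (pp. 11–12)] -/
theorem borelCuspForms_le_automorphicForms :
    borelCuspForms F E c N hcpt ≤ automorphicForms (quasiSplitDatum F E c N hcpt) :=
  Submodule.span_mono fun _ hφ => hφ.1

/-- **Every element of `borelCuspForms` satisfies the Borel cusp condition** (the condition is
linear: `BorelCuspCondition.zero/add/smul`). [cite: Rogawski1990, §2.1 (pp. 11–12)] -/
theorem borelCuspCondition_of_mem_borelCuspForms {φ : (quasiSplit F E c N).Adelic → ℂ}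
    (hφ : φ ∈ borelCuspForms F E c N hcpt) : BorelCuspCondition F E c N φ := by
  induction hφ using Submodule.span_induction with
  | mem x hx => exact hx.2
  | zero => exact BorelCuspCondition.zero
  | add x y _ _ hx hy => exact hx.add hy
  | smul a x _ hx => exact hx.smul a

/-- **Every element of `borelCuspForms` is left `U(F)`-invariant** (the condition is linear).
[cite: Rogawski1990, §2.1 (pp. 11–12)] -/
theorem isLeftInvariant_of_mem_borelCuspForms {φ : (quasiSplit F E c N).Adelic → ℂ}
    (hφ : φ ∈ borelCuspForms F E c N hcpt) : IsLeftInvariant (quasiSplit F E c N) φ := by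
  induction hφ using Submodule.span_induction with
  | mem x hx => exact hx.1.leftInvariant
  | zero => intro γ _ g; rfl
  | add x y _ _ hx hy => intro γ hγ g; simp only [Pi.add_apply, hx γ hγ g, hy γ hγ g]
  | smul a x _ hx => intro γ hγ g; simp only [Pi.smul_apply, hx γ hγ g]

/-- Hence every element of `borelCuspForms` is Borel-cuspidal for every Haar measure of `N(𝔸_F)`
and every fundamental domain of `N(F)`. [cite: Rogawski1990, §2.1 (pp. 11–12)] -/
theorem isBorelCuspidal_of_mem_borelCuspForms [MeasurableSpace (adelicUnipotent F E c N)]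
    [BorelSpace (adelicUnipotent F E c N)] {φ : (quasiSplit F E c N).Adelic → ℂ}
    (hφ : φ ∈ borelCuspForms F E c N hcpt) (ν : Measure (adelicUnipotent F E c N)) [ν.IsHaarMeasure]
    {𝓕 : Set (adelicUnipotent F E c N)} (h𝓕 : IsFundamentalDomain (rationalUnipotent F E c N) 𝓕 ν) :
    IsBorelCuspidal ν 𝓕 φ :=
  BorelCuspCondition.isBorelCuspidal (borelCuspCondition_of_mem_borelCuspForms hφ) ν h𝓕

/-- On Borel cusp forms Arthur's rank-one truncation is the identity: `Λ^T φ = φ`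
(`BorelCuspCondition.truncation_eq`). [cite: Rogawski1990, §2.2] -/
theorem truncation_eq_of_mem_borelCuspForms [NeZero N] [MeasurableSpace (adelicUnipotent F E c N)]
    [BorelSpace (adelicUnipotent F E c N)] {φ : (quasiSplit F E c N).Adelic → ℂ}
    (hφ : φ ∈ borelCuspForms F E c N hcpt) (ν : Measure (adelicUnipotent F E c N)) [ν.IsHaarMeasure]
    {𝓕 : Set (adelicUnipotent F E c N)} (h𝓕 : IsFundamentalDomain (rationalUnipotent F E c N) 𝓕 ν)
    (T : NNReal) (g : (quasiSplit F E c N).Adelic) : truncation ν 𝓕 T φ g = φ g :=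
  BorelCuspCondition.truncation_eq (borelCuspCondition_of_mem_borelCuspForms hφ) ν h𝓕 T g

end UnitaryGroup

end Literature.NumberTheory.Automorphic
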